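import Summits.NavierStokesRegularity.FunctionalMining.NoGo.LogDoorWitness
import Summits.NavierStokesRegularity.FunctionalMining.NoGo.LogDoorSecondVariation
import Summits.NavierStokesRegularity.FunctionalMining.NoGo.LogDoorExpansion
import HarnessLib

/-!
# NO-GO N6 (kernel-checked): the unlogged palinstrophy / sup-vorticity bound fails for EVERY constant

Search for candidate a priori estimates; no regularity claim. NS FUNCTIONAL MINING — NO-GO BRANCH
(cell `pub-nsfunc`, prove seat gen 3; statement and paper-level proof by the no-go seat,
`NoGo/PalinstrophySupRate.lean`, `pub-nsfunc-nogo/LOGDOOR.md` §1).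

`palinstrophySupRateFails_fin3 : PalinstrophySupRateFails (d := Fin 3)`, i.e. for every real `C`
there is a smooth divergence-free field `v` on `T³` and a vorticity majorant `M` (`|ω_v| ≤ M`) with
`−∫⟪(v·∇)v, Δ²v⟫ > C · M · ∫‖Δv‖²`; by `palinstrophyRateSupFails_of_supRateFails` the dynamic row
`d𝒫/dt ≤ C‖ω‖_∞𝒫` (K0 `EF.s=2|T_C|C1`) then fails along classical Navier–Stokes solutions for every
`C`: the log door (D4, `PalinstrophyLogBudget`) is NECESSARY.

Proof (this file assembles the chain `LogDoor*`; profiles, supports, planting and Step 1 are in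
`NoGo/LogDoorWitness.lean`): on `ℝ³` take the bounded-vorticity background
`G_n` (`NoGo/LogDoorBackgroundField`, vorticity `≤ M₀` uniformly in `n`, equal to the linear strain
`E = n η(z)(x,−y,0)` on its core) and the shear packet `W_K` (`NoGo/LogDoorPacket`, profiles
`a = bumpA(·/r)`, `g_K = a cos(K·)/K²`, `η = bumpA(2·)`) inside the core. Planting `G_n ± W_K` on `T³`
(`QuadraticBudgetPlanting`, `torusVorticitySqAt_periodize`) and adding the two instances of the bound
isolates the second variation (`production2_add_add_sub`), which by locality and
`integral_qint` equals `n ∫η³ (Sq a 3 Sq g 0 + Sq a 2 Sq g 1 − Sq a 1 Sq g 2 − Sq a 0 Sq g 3)`, while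
`∫‖Δ(G±W)‖²` sums to `2∫‖ΔG‖² + 2∫‖ΔW_K‖²` with `∫‖ΔW_K‖² = ∫η² · Sq a 0 · Sq g_K 3 + O(1)`. With
`n ∫η³ > C M ∫η²` fixed first and then `K → ∞` (`Sq g_K 3 → ∞`, `Sq g_K l` bounded for `l ≤ 2`,
`NoGo/LogDoorOscillation`) the bound is violated. Nothing here is a statement about solutions of
Navier–Stokes beyond the instantaneous identity; it is a negative result about one candidate inequality.
-/

noncomputable section

open MeasureTheory Set Function Filter Real
open scoped ContDiff Topology Laplacian InnerProductSpace RealInnerProductSpace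

namespace Summit.NavierStokesRegularity.FunctionalMining

open Literature.Analysis.FunctionSpaces Literature.Analysis.FluidPDE Sep3

/-- `∞ ≠ 0` in `WithTop ℕ∞`. [folklore] -/
private theorem infty_ne_zero₉ : (∞ : WithTop ℕ∞) ≠ 0 := by simp

namespace LogDoor

/-- **Step 2 (the master inequality).** If `PalinstrophySupRateBound C'` holds and the vorticity of
`G_n ± W_K` is at most `M²`, then planting both fields, adding, expanding and localising gives
`−P₂(G) − n (∫η³)(Sq a 3 Sq g 0 + Sq a 2 Sq g 1 − Sq a 1 Sq g 2 − Sq a 0 Sq g 3) ≤ C'M(∫‖ΔG‖² + ∫‖ΔW‖²)`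
with `∫‖ΔW‖²` in closed form. [folklore] -/
theorem master_ineq {C' M : ℝ} (hC' : PalinstrophySupRateBound (d := Fin 3) C') (hM : 0 ≤ M)
    (n : ℕ) {r K : ℝ} (hr0 : 0 < r) (hr4 : r ≤ 1 / 4) (hcore : (4 : ℝ) ^ n * (8 * r ^ 2) < 2)
    (hvort : ∀ y, eVortSq (fun z => background n etaZ z + packet (prof r K) z) y ≤ M ^ 2 ∧
      eVortSq (fun z => background n etaZ z - packet (prof r K) z) y ≤ M ^ 2) :
    -(∫ y, ⟪fderiv ℝ (background n etaZ) y (background n etaZ y), Δ (Δ (background n etaZ)) y⟫) -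
      (n : ℝ) * J etaZ (0, 0, 0) *
        (Sq (bumpR r) 3 * Sq (gK (bumpR r) K) 0 + Sq (bumpR r) 2 * Sq (gK (bumpR r) K) 1 -
          Sq (bumpR r) 1 * Sq (gK (bumpR r) K) 2 - Sq (bumpR r) 0 * Sq (gK (bumpR r) K) 3) ≤
      C' * M * ((∫ y, ‖Δ (background n etaZ) y‖ ^ 2) +
        (Sq etaZ 0 * (Sq (bumpR r) 0 * Sq (gK (bumpR r) K) 3 + 3 * (Sq (bumpR r) 1 * Sq (gK (bumpR r) K) 2) +
            3 * (Sq (bumpR r) 2 * Sq (gK (bumpR r) K) 1) + Sq (bumpR r) 3 * Sq (gK (bumpR r) K) 0) +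
          2 * Sq etaZ 1 * (Sq (bumpR r) 0 * Sq (gK (bumpR r) K) 2 + 2 * (Sq (bumpR r) 1 * Sq (gK (bumpR r) K) 1) +
            Sq (bumpR r) 2 * Sq (gK (bumpR r) K) 0) +
          Sq etaZ 2 * (Sq (bumpR r) 0 * Sq (gK (bumpR r) K) 1 + Sq (bumpR r) 1 * Sq (gK (bumpR r) K) 0))) := by
  have hr1 : r ≤ 1 := by linarith
  set G : E3 → E3 := background n etaZ with hGdef
  set φ : Fin 3 → ℝ → ℝ := prof r K with hφdef
  have hφ : ∀ i, ContDiff ℝ ∞ (φ i) := prof_contDiff r K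
  have hφ0 : ∀ i t, 2 < |t| → φ i t = 0 := prof_eq_zero hr0 hr1 K
  set W : E3 → E3 := packet φ with hWdef
  have hGs : ContDiff ℝ ∞ G := contDiff_background etaZ_contDiff
  have hWs : ContDiff ℝ ∞ W := contDiff_packet hφ
  have hGd : Differentiable ℝ G := hGs.differentiable infty_ne_zero₉
  have hWd : Differentiable ℝ W := hWs.differentiable infty_ne_zero₉
  have hts : ∀ t s : ℝ, tsupport (fun y => t • G y + s • W y) ⊆ Metric.closedBall 0 2 :=
    fun t s => tsupport_subset hr0 hr4 K n t s
  have hUp_ts : tsupport (fun y => G y + W y) ⊆ Metric.closedBall 0 2 := by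
    simpa [one_smul] using hts 1 1
  have hUm_ts : tsupport (fun y => G y - W y) ⊆ Metric.closedBall 0 2 := by
    simpa [one_smul, sub_eq_add_neg] using hts 1 (-1)
  have hG_ts : tsupport G ⊆ Metric.closedBall 0 2 := by simpa using hts 1 0
  have hW_ts : tsupport W ⊆ Metric.closedBall 0 2 := by simpa using hts 0 1
  have hGc : HasCompactSupport G :=
    HasCompactSupport.of_support_subset_isCompact (isCompact_closedBall 0 2) (subset_closure.trans hG_ts)
  have hWc : HasCompactSupport W :=
    HasCompactSupport.of_support_subset_isCompact (isCompact_closedBall 0 2) (subset_closure.trans hW_ts)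
  have hGtr : ∀ y, LinearMap.trace ℝ E3 (fderiv ℝ G y : E3 →ₗ[ℝ] E3) = 0 :=
    background_trace etaZ_contDiff
  have hWtr : ∀ y, LinearMap.trace ℝ E3 (fderiv ℝ W y : E3 →ₗ[ℝ] E3) = 0 := packet_trace hφ
  have hUp_tr : ∀ y, LinearMap.trace ℝ E3 (fderiv ℝ (fun z => G z + W z) y : E3 →ₗ[ℝ] E3) = 0 := by
    intro y
    rw [fderiv_fun_add (hGd y) (hWd y), ContinuousLinearMap.toLinearMap_add, map_add, hGtr y, hWtr y, add_zero]
  have hUm_tr : ∀ y, LinearMap.trace ℝ E3 (fderiv ℝ (fun z => G z - W z) y : E3 →ₗ[ℝ] E3) = 0 := by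
    intro y
    rw [fderiv_fun_sub (hGd y) (hWd y), ContinuousLinearMap.toLinearMap_sub, map_sub, hGtr y, hWtr y, sub_zero]
  have hPp := neg_production2_le hC' hM (hGs.add hWs) hUp_ts hUp_tr fun y => (hvort y).1
  have hPm := neg_production2_le hC' hM (hGs.sub hWs) hUm_ts hUm_tr fun y => (hvort y).2
  have hexp := production2_add_add_sub hGs hWs hGc hWc
  have hpar := laplacianNormSq_add_add_sub hGs hWs hGc hWc
  have hpar' : C' * M * (∫ y, ‖Δ (fun z => G z + W z) y‖ ^ 2) +
      C' * M * (∫ y, ‖Δ (fun z => G z - W z) y‖ ^ 2) =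
      C' * M * (2 * (∫ y, ‖Δ G y‖ ^ 2) + 2 * ∫ y, ‖Δ W y‖ ^ 2) := by rw [← mul_add, hpar]
  -- locality
  have hU : IsOpen {y : E3 | (4 : ℝ) ^ n * Qr y < 2} :=
    isOpen_lt (continuous_const.mul contDiff_Qr.continuous) continuous_const
  have hGE : ∀ y ∈ {y : E3 | (4 : ℝ) ^ n * Qr y < 2}, G y = strain (n : ℝ) etaZ y :=
    fun y hy => background_eq_strain_of_core hy
  have hWU : ∀ y, y ∉ {y : E3 | (4 : ℝ) ^ n * Qr y < 2} → W =ᶠ[𝓝 y] fun _ => 0 := by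
    intro y hy
    apply packet_eventuallyEq_zero hr0 K
    by_contra hc
    rw [not_or, not_or, not_lt, not_lt] at hc
    have h0 : y 0 ^ 2 ≤ (2 * r) ^ 2 := by rw [← sq_abs]; nlinarith [abs_nonneg (y 0), hc.1]
    have h1 : y 1 ^ 2 ≤ (2 * r) ^ 2 := by rw [← sq_abs]; nlinarith [abs_nonneg (y 1), hc.2.1]
    apply hy
    show (4 : ℝ) ^ n * Qr y < 2
    have hQ : Qr y ≤ 8 * r ^ 2 := by unfold Qr; nlinarith
    calc (4 : ℝ) ^ n * Qr y ≤ 4 ^ n * (8 * r ^ 2) := mul_le_mul_of_nonneg_left hQ (by positivity)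
      _ < 2 := hcore
  have hloc : (∫ y, (⟪fderiv ℝ W y (W y), Δ (Δ G) y⟫ + ⟪fderiv ℝ G y (W y), Δ (Δ W) y⟫ +
      ⟪fderiv ℝ W y (G y), Δ (Δ W) y⟫)) = ∫ y, qint φ n y :=
    integral_congr_ae (ae_of_all _ fun y => secondVariation_congr_of_local hU hGE hWU y)
  have hQ := integral_qint hφ hφ0 (n : ℝ)
  have hPW := integral_norm_sq_laplacian_packet hφ hφ0
  simp only [hφdef, prof_zero, prof_one, prof_two] at hQ hPW
  rw [← hPW, ← hQ, ← hloc]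
  linarith [hPp, hPm, hexp, hpar']

/-- **Step 3 (real endgame).** The master inequality with `n ∫η³ ≥ C'M ∫η² + 1`, the bounds
`Sq g_K l ≤ s_l` (`l ≤ 2`) and `Sq g_K 3 ≥ K²r/2 − K/2 − 4C₃² > |R̄|/S₀(a)` is contradictory.
[folklore] -/
theorem real_endgame {cm NJ e0 e1 e2 a0 a1 a2 a3 g0 g1 g2 g3 s0 s1 s2 PG P2G C3 T K r : ℝ}
    (hcm : 0 ≤ cm) (hNJ : 0 ≤ NJ) (hn : cm * e0 + 1 ≤ NJ) (he0 : 0 ≤ e0) (he1 : 0 ≤ e1) (he2 : 0 ≤ e2)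
    (ha0 : 0 < a0) (ha1 : 0 ≤ a1) (ha2 : 0 ≤ a2) (ha3 : 0 ≤ a3)
    (hg2n : 0 ≤ g2) (hg3n : 0 ≤ g3) (hg0 : g0 ≤ s0) (hg1 : g1 ≤ s1) (hg2 : g2 ≤ s2)
    (hg3 : K ^ 2 * r / 2 - K / 2 - 4 * C3 ^ 2 ≤ g3)
    (hT : T = |cm * PG + P2G + NJ * (a3 * s0 + a2 * s1) + cm * (e0 * (3 * (a1 * s2) + 3 * (a2 * s1) + a3 * s0) +
      2 * e1 * (a0 * s2 + 2 * (a1 * s1) + a2 * s0) + e2 * (a0 * s1 + a1 * s0))| / a0 + 4 * C3 ^ 2)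
    (hK3 : T < K ^ 2 * r / 2 - K / 2)
    (MI : -P2G - NJ * (a3 * g0 + a2 * g1 - a1 * g2 - a0 * g3) ≤
      cm * (PG + (e0 * (a0 * g3 + 3 * (a1 * g2) + 3 * (a2 * g1) + a3 * g0) +
        2 * e1 * (a0 * g2 + 2 * (a1 * g1) + a2 * g0) + e2 * (a0 * g1 + a1 * g0)))) : False := by
  set Rbar : ℝ := cm * PG + P2G + NJ * (a3 * s0 + a2 * s1) + cm * (e0 * (3 * (a1 * s2) + 3 * (a2 * s1) + a3 * s0) +
      2 * e1 * (a0 * s2 + 2 * (a1 * s1) + a2 * s0) + e2 * (a0 * s1 + a1 * s0)) with hRbar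
  have p1 : NJ * (a3 * g0) ≤ NJ * (a3 * s0) := mul_le_mul_of_nonneg_left (mul_le_mul_of_nonneg_left hg0 ha3) hNJ
  have p2 : NJ * (a2 * g1) ≤ NJ * (a2 * s1) := mul_le_mul_of_nonneg_left (mul_le_mul_of_nonneg_left hg1 ha2) hNJ
  have p3 : 0 ≤ NJ * (a1 * g2) := by positivity
  have q01 : cm * (e0 * (a1 * g2)) ≤ cm * (e0 * (a1 * s2)) :=
    mul_le_mul_of_nonneg_left (mul_le_mul_of_nonneg_left (mul_le_mul_of_nonneg_left hg2 ha1) he0) hcm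
  have q02 : cm * (e0 * (a2 * g1)) ≤ cm * (e0 * (a2 * s1)) :=
    mul_le_mul_of_nonneg_left (mul_le_mul_of_nonneg_left (mul_le_mul_of_nonneg_left hg1 ha2) he0) hcm
  have q03 : cm * (e0 * (a3 * g0)) ≤ cm * (e0 * (a3 * s0)) :=
    mul_le_mul_of_nonneg_left (mul_le_mul_of_nonneg_left (mul_le_mul_of_nonneg_left hg0 ha3) he0) hcm
  have q11 : cm * (e1 * (a0 * g2)) ≤ cm * (e1 * (a0 * s2)) :=
    mul_le_mul_of_nonneg_left (mul_le_mul_of_nonneg_left (mul_le_mul_of_nonneg_left hg2 ha0.le) he1) hcm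
  have q12 : cm * (e1 * (a1 * g1)) ≤ cm * (e1 * (a1 * s1)) :=
    mul_le_mul_of_nonneg_left (mul_le_mul_of_nonneg_left (mul_le_mul_of_nonneg_left hg1 ha1) he1) hcm
  have q13 : cm * (e1 * (a2 * g0)) ≤ cm * (e1 * (a2 * s0)) :=
    mul_le_mul_of_nonneg_left (mul_le_mul_of_nonneg_left (mul_le_mul_of_nonneg_left hg0 ha2) he1) hcm
  have q21 : cm * (e2 * (a0 * g1)) ≤ cm * (e2 * (a0 * s1)) :=
    mul_le_mul_of_nonneg_left (mul_le_mul_of_nonneg_left (mul_le_mul_of_nonneg_left hg1 ha0.le) he2) hcm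
  have q22 : cm * (e2 * (a1 * g0)) ≤ cm * (e2 * (a1 * s0)) :=
    mul_le_mul_of_nonneg_left (mul_le_mul_of_nonneg_left (mul_le_mul_of_nonneg_left hg0 ha1) he2) hcm
  have hX0 : 0 ≤ a0 * g3 := by positivity
  have hcoef : a0 * g3 ≤ NJ * (a0 * g3) - cm * (e0 * (a0 * g3)) := by
    have : 0 ≤ (NJ - cm * e0 - 1) * (a0 * g3) := mul_nonneg (by linarith) hX0
    linarith
  have hXle : a0 * g3 ≤ Rbar := by
    rw [hRbar]
    linarith [MI, p1, p2, p3, hcoef, q01, q02, q03, q11, q12, q13, q21, q22]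
  have hXgt : |Rbar| < a0 * g3 := by
    have h1 : T - 4 * C3 ^ 2 < g3 := by linarith
    have h2 : a0 * (T - 4 * C3 ^ 2) = |Rbar| := by
      rw [hT]; field_simp; ring
    rw [← h2]
    exact mul_lt_mul_of_pos_left h1 ha0
  linarith [le_abs_self Rbar]

/-! ## The refutation -/

set_option maxHeartbeats 400000 in
/-- **NO-GO N6 (kernel-checked): `PalinstrophySupRateFails` in dimension three.** For every real
`C` the static bound `−∫⟪(v·∇)v, Δ²v⟫ ≤ C · M · ∫‖Δv‖²` (all smooth divergence-free `v` on `T³`,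
all vorticity majorants `M`) FAILS: witness = planted `G_n ± W_K` (bounded-vorticity linear-strain
core of rate `n` + shear packet of frequency `K`), `n` chosen against `C` and the UNIFORM vorticity
bound, then `K` large. Search for candidate a priori estimates; no regularity claim. [folklore] -/
theorem palinstrophySupRateFails_fin3 : PalinstrophySupRateFails (d := Fin 3) := by
  intro C hC
  -- (0) a positive constant
  set C' : ℝ := max C 0 + 1 with hC'def
  have hC'0 : 0 < C' := by have := le_max_right C 0; linarith
  have hC' : PalinstrophySupRateBound (d := Fin 3) C' :=
    palinstrophySupRateBound_mono (by have := le_max_left C 0; linarith) hC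
  -- (1) profile constants
  obtain ⟨B₁, hB₁, hb1⟩ := exists_bound_iteratedDeriv_stepB 1
  obtain ⟨B₂, hB₂, hb2⟩ := exists_bound_iteratedDeriv_stepB 2
  obtain ⟨E₁, hE₁, hE1⟩ := exists_bound_iteratedDeriv etaZ_contDiff etaZ_zero 1
  set Msq : ℝ := ((24 * B₁ + 32 * B₂) * 1 + 2) ^ 2 + ((2 + 8 * B₁) * E₁ + 1) ^ 2 +
    ((2 + 8 * B₁) * E₁ + 1) ^ 2 with hMsq
  have hMsq0 : 0 ≤ Msq := by positivity
  set M : ℝ := Real.sqrt Msq with hMdef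
  have hM0 : 0 ≤ M := Real.sqrt_nonneg _
  have hM2 : M ^ 2 = Msq := Real.sq_sqrt hMsq0
  have hCM : 0 ≤ C' * M := by positivity
  -- (2) `η`-integrals and the strain rate `n`
  have hJη : 0 < J etaZ (0, 0, 0) := by
    refine J_pos etaZ_contDiff etaZ_zero _ (fun t => ?_) (t₀ := 0) ?_
    · simp only [tri, iteratedDeriv_zero]
      have := (etaZ_facts t).2.1
      positivity
    · simp [tri, iteratedDeriv_zero, (etaZ_facts 0).2.2]
  obtain ⟨n, hn⟩ : ∃ n : ℕ, C' * M * Sq etaZ 0 + 1 ≤ (n : ℝ) * J etaZ (0, 0, 0) := by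
    refine ⟨⌈(C' * M * Sq etaZ 0 + 1) / J etaZ (0, 0, 0)⌉₊, ?_⟩
    have h := Nat.le_ceil ((C' * M * Sq etaZ 0 + 1) / J etaZ (0, 0, 0))
    rwa [div_le_iff₀ hJη] at h
  -- (3) the packet scale
  set r : ℝ := 1 / (4 * 2 ^ n) with hrdef
  have h2n : (1 : ℝ) ≤ 2 ^ n := one_le_pow₀ (by norm_num)
  have hr0 : 0 < r := by positivity
  have hr4 : r ≤ 1 / 4 := by
    rw [hrdef]; exact one_div_le_one_div_of_le (by norm_num) (by linarith)
  have hcore : (4 : ℝ) ^ n * (8 * r ^ 2) < 2 := by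
    have h4 : (4 : ℝ) ^ n = (2 ^ n) ^ 2 := by
      rw [← pow_mul, show (4 : ℝ) = 2 ^ 2 by norm_num, ← pow_mul]; ring_nf
    have : (4 : ℝ) ^ n * (8 * r ^ 2) = 1 / 2 := by
      rw [hrdef, h4]; field_simp; ring
    rw [this]; norm_num
  have ha : ContDiff ℝ ∞ (bumpR r) := bumpR_contDiff r
  have ha0 : ∀ t, 2 < |t| → bumpR r t = 0 := fun t ht => bumpR_eq_zero hr0 (by linarith)
  have ha1 : ∀ t, |t| ≤ r → bumpR r t = 1 := fun t ht => bumpR_eq_one hr0 ht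
  obtain ⟨A₁, hA₁, hA1⟩ := exists_bound_iteratedDeriv ha ha0 1
  obtain ⟨A₂, hA₂, hA2⟩ := exists_bound_iteratedDeriv ha ha0 2
  obtain ⟨A₃, hA₃, hA3⟩ := exists_bound_iteratedDeriv ha ha0 3
  have hA0 : ∀ t, |iteratedDeriv 0 (bumpR r) t| ≤ 1 := fun t => by
    rw [iteratedDeriv_zero]; exact abs_bumpR_le r t
  have ha0p : 0 < Sq (bumpR r) 0 := by
    rw [Sq]
    refine (ha.continuous_iteratedDeriv 0 (by exact_mod_cast le_top)).pow 2
      |>.integral_pos_of_hasCompactSupport_nonneg_nonzero ?_ (fun t => sq_nonneg _) (x := 0) ?_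
    · exact HasCompactSupport.intro (isCompact_Icc (a := (-2 : ℝ)) (b := 2)) fun t ht => by
        simp [iteratedDeriv_eq_zero_of_abs_lt ha0 0 t (two_lt_abs_of_not_mem_Icc ht)]
    · simp [iteratedDeriv_zero, ha1 0 (by simpa using hr0.le)]
  -- (4) the target constant and the frequency
  set s₀ : ℝ := 4 * 1 ^ 2 with hs0
  set s₁ : ℝ := 4 * (A₁ + 1) ^ 2 with hs1
  set s₂ : ℝ := 4 * (A₂ + 1 + 2 * A₁) ^ 2 with hs2
  set C₃ : ℝ := A₃ + 3 * A₁ + 3 * A₂ with hC3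
  set PG : ℝ := ∫ y, ‖Δ (background n etaZ) y‖ ^ 2 with hPGdef
  set P2G : ℝ := ∫ y, ⟪fderiv ℝ (background n etaZ) y (background n etaZ y), Δ (Δ (background n etaZ)) y⟫
    with hP2Gdef
  set cm : ℝ := C' * M with hcm
  set NJ : ℝ := (n : ℝ) * J etaZ (0, 0, 0) with hNJdef
  have hNJ0 : 0 ≤ NJ := by positivity
  set a0 := Sq (bumpR r) 0
  set a1 := Sq (bumpR r) 1
  set a2 := Sq (bumpR r) 2
  set a3 := Sq (bumpR r) 3
  set e0 := Sq etaZ 0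
  set e1 := Sq etaZ 1
  set e2 := Sq etaZ 2
  set T : ℝ := |cm * PG + P2G + NJ * (a3 * s₀ + a2 * s₁) + cm * (e0 * (3 * (a1 * s₂) + 3 * (a2 * s₁) + a3 * s₀) +
      2 * e1 * (a0 * s₂ + 2 * (a1 * s₁) + a2 * s₀) + e2 * (a0 * s₁ + a1 * s₀))| / a0 + 4 * C₃ ^ 2 with hTdef
  have hT0 : 0 ≤ T := by positivity
  set K : ℝ := max (1 + 2 * A₁ + 2 * A₂ + (A₁ + 1) * E₁ + A₁ * E₁) (2 * (T + 2) / r) with hKdef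
  have hKK : 1 + 2 * A₁ + 2 * A₂ + (A₁ + 1) * E₁ + A₁ * E₁ ≤ K := le_max_left _ _
  have hK1 : 1 ≤ K := le_trans (by nlinarith) hKK
  have hKr : 2 * (T + 2) ≤ K * r := by
    have := le_max_right (1 + 2 * A₁ + 2 * A₂ + (A₁ + 1) * E₁ + A₁ * E₁) (2 * (T + 2) / r)
    rwa [div_le_iff₀ hr0] at this
  have hK3 : T < K ^ 2 * r / 2 - K / 2 := by nlinarith
  -- (5) steps 1–3
  have hvort := fun y => witness_vorticity n hB₁ hB₂ hb1 hb2 hE1 hA₂ hA1 hA2 hK1 hKK y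
  have MI := master_ineq hC' hM0 n hr0 hr4 hcore (K := K) fun y => by rw [hM2]; exact hvort y
  have hg0 : Sq (gK (bumpR r) K) 0 ≤ s₀ := Sq_gK_le ha ha0 K 0 fun t => abs_gK_le hK1 hA0 t
  have hg1 : Sq (gK (bumpR r) K) 1 ≤ s₁ :=
    Sq_gK_le ha ha0 K 1 fun t => abs_iteratedDeriv_gK_one_le ha hK1 hA0 hA1 t
  have hg2 : Sq (gK (bumpR r) K) 2 ≤ s₂ :=
    Sq_gK_le ha ha0 K 2 fun t => abs_iteratedDeriv_gK_two_le ha hK1 hA0 hA1 hA2 t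
  have hg3 : K ^ 2 * r / 2 - K / 2 - 4 * C₃ ^ 2 ≤ Sq (gK (bumpR r) K) 3 :=
    Sq_gK_three_ge ha ha0 hr0.le ha1 hK1 fun t => by
      simpa [iteratedDeriv_zero] using abs_iteratedDeriv_gK_three_sub_le ha hK1 hA1 hA2 hA3 t
  exact real_endgame hCM hNJ0 hn (Sq_nonneg _ _) (Sq_nonneg _ _) (Sq_nonneg _ _) ha0p (Sq_nonneg _ _)
    (Sq_nonneg _ _) (Sq_nonneg _ _) (Sq_nonneg _ _) (Sq_nonneg _ _) hg0 hg1 hg2 hg3 hTdef hK3 MI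

end LogDoor

open LogDoor in
/-- **NO-GO N6, exported**: the no-go seat's conjecture-tagged `PalinstrophySupRateFails` HOLDS in
dimension three (`palinstrophySupRateFails_fin3`), and with it the dynamic `PalinstrophyRateSupFails`
(row `EF.s=2|T_C|C1` dead for every `C`; the log door `PalinstrophyLogBudget` is the minimal admissible
shape). Search for candidate a priori estimates; no regularity claim. [folklore] -/
theorem palinstrophyRateSupFails_fin3 : PalinstrophyRateSupFails (d := Fin 3) :=
  palinstrophyRateSupFails_of_supRateFails LogDoor.palinstrophySupRateFails_fin3

end Summit.NavierStokesRegularity.FunctionalMining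

end
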